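import Summits.Ventures.CertifiedQuantumChemistry.Certificates.HubbardRingL4SectorDQGDualCheckR0
import Summits.Ventures.CertifiedQuantumChemistry.Certificates.HubbardRingL4SectorDQGDualCheckR1
import Summits.Ventures.CertifiedQuantumChemistry.Certificates.HubbardRingL4SectorDQGDualCheckS0
import Summits.Ventures.CertifiedQuantumChemistry.Certificates.HubbardRingL4SectorDQGDualCheckS1
import Summits.Ventures.CertifiedQuantumChemistry.Certificates.HubbardRingL4SectorDQGDualCheckR2a
import Summits.Ventures.CertifiedQuantumChemistry.Certificates.HubbardRingL4SectorDQGDualCheckR2b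
import Summits.Ventures.CertifiedQuantumChemistry.Certificates.HubbardRingL4SectorDQGDualCheckR3a
import Summits.Ventures.CertifiedQuantumChemistry.Certificates.HubbardRingL4SectorDQGDualCheckR3b
import Summits.Ventures.CertifiedQuantumChemistry.Certificates.HubbardRingL4SectorDQGDualCheckR4a
import Summits.Ventures.CertifiedQuantumChemistry.Certificates.HubbardRingL4SectorDQGDualCheckR4b
import Summits.Ventures.CertifiedQuantumChemistry.Certificates.HubbardRingL4SectorDQGDualCheckS2a
import Summits.Ventures.CertifiedQuantumChemistry.Certificates.HubbardRingL4SectorDQGDualCheckS2b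
import Summits.Ventures.CertifiedQuantumChemistry.Certificates.HubbardRingL4SectorDQGDualCheckS3a
import Summits.Ventures.CertifiedQuantumChemistry.Certificates.HubbardRingL4SectorDQGDualCheckS3b
import Summits.Ventures.CertifiedQuantumChemistry.Certificates.HubbardRingL4SectorDQGDualCheckS4a
import Summits.Ventures.CertifiedQuantumChemistry.Certificates.HubbardRingL4SectorDQGDualCheckS4b
import Summits.Ventures.CertifiedQuantumChemistry.Certificates.HubbardRingL4LiftPlateauFloor
import HarnessLib

/-!
# Ventures/CertifiedQuantumChemistry — Certificates/HubbardRingL4SectorDQGDualCeiling.lean: THE KERNEL-GRADE CEILING AT `L = 4`, LEVEL DQG —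
# `U·E_PQG(hubbardRingTV 4 1 U; 2, 2) ≥ −8 − 4√2 − (270559 + 358949√2)/(4096·U²)` for EVERY `U > 0`; hence, with gen 42's floor,
# `lim_U (U/4)·(E₀ − OPT_DQG)(4; U) = √2 − 1` EXISTS: `c_DQG(4) = √2 − 1` at kernel grade

HONEST FRAMING (verbatim): certified bounds for a stated model Hamiltonian in a stated basis; not a claim about the real molecule beyond that model. A dual bound for the cell's own RELAXATION of its own model object (the `t–U` 4-ring); no
row of `CERTIFIED.md`, no claim node; the conjecture leaves (`Rows/ConjectureSU*.lean`) are NOT edited here.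

Seat rdm-B (gen 45). The explicit finite-`U` dual certificate family of `…Family.lean` (columns and cores over `ℚ(√2)`, written as pairs of
rational records) passes both checks at every order (`…Check{R,S}{0,1}.lean` in one piece, `…Check{R,S}{2,3,4}{a,b}.lean` in kernel slices combined in §0) and its three combined tables are positive semidefinite at every
rational `ε = 1/U`, so gen 45's pair soundness theorem (`DualL4.Dual.le_of_check_sector_pair`, `Certificates/HubbardRingL4SectorDualPair.lean`)
gives **`pqgSectorEnergy_ge`**: `(−8 − 4√2)/U − (270559 + 358949√2)/(4096·U³) ≤ Model.pqgSectorEnergy (hubbardRingTV 4 1 U) 2 2` for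
every rational `U > 0` — a LOWER bound on the level-DQG relaxation VALUE of the ring, uniform in `U` at the scale `1/U`, reaching the
value `−8 − 4√2` of gen 42's primal lift (`Certificates/HubbardRingL4LiftPlateauFloor.lean`: `U·OPT_DQG ≤ −8 − 4√2 + 4δ` eventually). With
the typer's `U·E₀(4; U) → −12` (`Rows/HubbardRingStrongCouplingLimit.lean`): **`scaled_gap_le`** and **`tendsto_scaled_gap`**:
`Tendsto (fun U : ℚ => (U/4)·(Model.energy (hubbardRingTV 4 1 U) 2 2 − Model.pqgSectorEnergy (hubbardRingTV 4 1 U) 2 2)) atTop (𝓝 (√2 − 1))`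
— the `n = 2` `Tendsto` conjunct of `ConjectureSU2_DQG` / `ConjectureSU_DQG` with the conjectured value (`conjectureSU2_DQG_tendsto_two`,
`eq_sqrt_two_sub_one_of_clause`: any plateau function satisfying the clause has `c 2 = √2 − 1`) at KERNEL grade, with NO appeal to the
X_∞ limit programmes or to CLAIM N. READING (rdm-B's, of its own files): at strong coupling the two-positivity (DQG) relaxation of the
half-filled 4-ring on the `S_z = 0` sector misses exactly `(√2 − 1)·J` of the ground-state energy to order `J = 4t²/U` — together with
gen 44's `c_DQG+S²(4) = 0` this is the whole `L = 4` content of conjecture S-U v0.2 at kernel grade. The conjecture itself (all `n`,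
monotonicity, the `L = 6` brackets) is neither proved nor refuted here. 0 sorry, 0 def; standard axioms.
-/

set_option linter.style.longLine false

namespace Summit.Ventures.CertifiedQuantumChemistry


namespace DualL4.SectorDQG

open Matrix Finset Filter Topology
open Literature.MathematicalPhysics.QuantumLattice Literature.MathematicalPhysics.QuantumChemistry
open Summit.Ventures.CertifiedQuantumChemistry.Hamiltonians

/-! ## §0 The sliced checks combined (orders 2–4; orders 0–1 of each part are decided in one piece in their own files) -/

/-- **Order `2` of the rational part passes the check** (from the kernel slices of `…CheckR2a/b.lean`). -/
theorem checkR2 : (dualR 2).check = true := by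
  simp only [Dual.check, decide_eq_true_eq]
  refine ⟨?_, checkR2_h, checkR2_c⟩
  intro p; fin_cases p
  exacts [checkR2_g0, checkR2_g1, checkR2_g2, checkR2_g3]

/-- **Order `3` of the rational part passes the check** (from the kernel slices of `…CheckR3a/b.lean`). -/
theorem checkR3 : (dualR 3).check = true := by
  simp only [Dual.check, decide_eq_true_eq]
  refine ⟨?_, checkR3_h, checkR3_c⟩
  intro p; fin_cases p
  exacts [checkR3_g0, checkR3_g1, checkR3_g2, checkR3_g3]

/-- **Order `4` of the rational part passes the check** (from the kernel slices of `…CheckR4a/b.lean`). -/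
theorem checkR4 : (dualR 4).check = true := by
  simp only [Dual.check, decide_eq_true_eq]
  refine ⟨?_, checkR4_h, checkR4_c⟩
  intro p; fin_cases p
  exacts [checkR4_g0, checkR4_g1, checkR4_g2, checkR4_g3]

/-- **Order `2` of the `√2` part passes the check** (from the kernel slices of `…CheckS2a/b.lean`). -/
theorem checkS2 : (dualS 2).check = true := by
  simp only [Dual.check, decide_eq_true_eq]
  refine ⟨?_, checkS2_h, checkS2_c⟩
  intro p; fin_cases p
  exacts [checkS2_g0, checkS2_g1, checkS2_g2, checkS2_g3]

/-- **Order `3` of the `√2` part passes the check** (from the kernel slices of `…CheckS3a/b.lean`). -/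
theorem checkS3 : (dualS 3).check = true := by
  simp only [Dual.check, decide_eq_true_eq]
  refine ⟨?_, checkS3_h, checkS3_c⟩
  intro p; fin_cases p
  exacts [checkS3_g0, checkS3_g1, checkS3_g2, checkS3_g3]

/-- **Order `4` of the `√2` part passes the check** (from the kernel slices of `…CheckS4a/b.lean`). -/
theorem checkS4 : (dualS 4).check = true := by
  simp only [Dual.check, decide_eq_true_eq]
  refine ⟨?_, checkS4_h, checkS4_c⟩
  intro p; fin_cases p
  exacts [checkS4_g0, checkS4_g1, checkS4_g2, checkS4_g3]

/-! ## §1 The family passes both checks at every `ε`; its target and bound -/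

/-- All five orders of the rational part pass, hence every `ε`-combination passes. -/
theorem checkR_all (ε : ℚ) : (polyDual dualR ε).check = true :=
  check_polyDual dualR (fun m => by fin_cases m; exacts [checkR0, checkR1, checkR2, checkR3, checkR4]) ε

/-- All five orders of the `√2` part pass, hence every `ε`-combination passes. -/
theorem checkS_all (ε : ℚ) : (polyDual dualS ε).check = true :=
  check_polyDual dualS (fun m => by fin_cases m; exacts [checkS0, checkS1, checkS2, checkS3, checkS4]) ε

/-- No spin row in the rational part. -/
theorem xiR_eq (ε : ℚ) : (polyDual dualR ε).xi = 0 := by simp [polyDual, dualR]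
/-- No spin row in the `√2` part. -/
theorem xiS_eq (ε : ℚ) : (polyDual dualS ε).xi = 0 := by simp [polyDual, dualS]
/-- Target, rational part: doublon coefficient `4096`. -/
theorem cdR_eq (ε : ℚ) : (polyDual dualR ε).cd = 4096 := by simp [polyDual, dualR, cdR, Fin.sum_univ_five]
/-- Target, `√2` part: doublon coefficient `0`. -/
theorem cdS_eq (ε : ℚ) : (polyDual dualS ε).cd = 0 := by simp [polyDual, dualS, cdS, Fin.sum_univ_five]
/-- Target, rational part: bond coefficient `−8192·ε`. -/
theorem chR_eq (ε : ℚ) : (polyDual dualR ε).ch = -8192 * ε := by simp [polyDual, dualR, chR, Fin.sum_univ_five, mul_comm]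
/-- Target, `√2` part: bond coefficient `0`. -/
theorem chS_eq (ε : ℚ) : (polyDual dualS ε).ch = 0 := by simp [polyDual, dualS, chS, Fin.sum_univ_five]
/-- Bound, rational part: `−8·4096·ε² − 270559·ε⁴`. -/
theorem muR_eq (ε : ℚ) : (polyDual dualR ε).mu = -32768 * ε ^ 2 - 270559 * ε ^ 4 := by
  simp [polyDual, dualR, muR, Fin.sum_univ_five]; ring
/-- Bound, `√2` part: `−4·4096·ε² − 358949·ε⁴`. -/
theorem muS_eq (ε : ℚ) : (polyDual dualS ε).mu = -16384 * ε ^ 2 - 358949 * ε ^ 4 := by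
  simp [polyDual, dualS, muS, Fin.sum_univ_five]; ring

/-! ## §2 THE CEILING: a lower bound on the level-DQG sector value, uniform in `U` at the scale `1/U` -/

/-- **`(−8 − 4√2)/U − (270559 + 358949√2)/(4096·U³) ≤ E_PQG(hubbardRingTV 4 1 U; 2, 2)` for every rational `U > 0`.** -/
theorem pqgSectorEnergy_ge (U : ℚ) (hU : 0 < U) :
    ((-8 : ℝ) - 4 * Real.sqrt 2) / U - ((270559 : ℝ) + 358949 * Real.sqrt 2) / 4096 / (U : ℝ) ^ 3
      ≤ Model.pqgSectorEnergy (hubbardRingTV 4 1 U) 2 2 := by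
  rw [Model.pqgSectorEnergy, le_pqgSectorEnergy_iff _ _ _ (by simp) (by simp)]
  intro γ Γ hs
  have h := Dual.le_of_check_sector_pair (polyDual dualR (1 / U)) (polyDual dualS (1 / U)) (checkR_all _) (checkS_all _)
    (xiR_eq _) (xiS_eq _) (posSemidef_zD_pair _) (posSemidef_zQ_pair _) (posSemidef_zG_pair _) hs
  rw [cdR_eq, cdS_eq, chR_eq, chS_eq, muR_eq, muS_eq] at h
  rw [RingEnergy.hubbardRingTV_re_rdmEnergy_eq_of_feasible (by norm_num) 1 U hs]
  push_cast at h ⊢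
  have hU' : (0 : ℝ) < U := by exact_mod_cast hU
  have hUne : (U : ℝ) ≠ 0 := hU'.ne'
  set D := ∑ p : Fin 4, (Γ (orb p 0, orb p 1) (orb p 0, orb p 1)).re with hD
  set B := ∑ p : Fin 4, ∑ σ : Fin 2, (γ (orb p σ) (orb (finRotate 4 p) σ)).re with hB
  have key := mul_le_mul_of_nonneg_left h (le_of_lt (by positivity : (0 : ℝ) < U / 4096))
  have e1 : (U : ℝ) / 4096 * (((4096 : ℝ) + Real.sqrt 2 * 0) * D + (-8192 * (1 / (U : ℝ)) + Real.sqrt 2 * 0) * B) =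
      -2 * (1 : ℝ) * B + (U : ℝ) * D := by
    field_simp; ring
  have e2 : (U : ℝ) / 4096 * (-32768 * (1 / (U : ℝ)) ^ 2 - 270559 * (1 / (U : ℝ)) ^ 4
      + Real.sqrt 2 * (-16384 * (1 / (U : ℝ)) ^ 2 - 358949 * (1 / (U : ℝ)) ^ 4)) =
      ((-8 : ℝ) - 4 * Real.sqrt 2) / U - ((270559 : ℝ) + 358949 * Real.sqrt 2) / 4096 / (U : ℝ) ^ 3 := by
    field_simp; ring
  linarith [key, e1, e2]

/-! ## §3 The scaled gap is squeezed: the strong-coupling limit EXISTS and equals `√2 − 1` -/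

/-- **`(U/4)·(E₀ − OPT_DQG) ≤ (U·E₀ + 8 + 4√2)/4 + (270559 + 358949√2)/(16384·U²)`** for every rational `U > 0`. -/
theorem scaled_gap_le (U : ℚ) (hU : 0 < U) :
    (U : ℝ) / 4 * (Model.energy (hubbardRingTV 4 1 U) 2 2 - Model.pqgSectorEnergy (hubbardRingTV 4 1 U) 2 2)
      ≤ ((U : ℝ) * Model.energy (hubbardRingTV 4 1 U) 2 2 + 8 + 4 * Real.sqrt 2) / 4
        + ((270559 : ℝ) + 358949 * Real.sqrt 2) / 16384 / (U : ℝ) ^ 2 := by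
  have h := pqgSectorEnergy_ge U hU
  have hU' : (0 : ℝ) < U := by exact_mod_cast hU
  have h1 : (U : ℝ) / 4 * (Model.energy (hubbardRingTV 4 1 U) 2 2 - Model.pqgSectorEnergy (hubbardRingTV 4 1 U) 2 2) ≤
      (U : ℝ) / 4 * (Model.energy (hubbardRingTV 4 1 U) 2 2
        - (((-8 : ℝ) - 4 * Real.sqrt 2) / U - ((270559 : ℝ) + 358949 * Real.sqrt 2) / 4096 / (U : ℝ) ^ 3)) :=
    mul_le_mul_of_nonneg_left (by linarith) (by positivity)
  have e : (U : ℝ) / 4 * (Model.energy (hubbardRingTV 4 1 U) 2 2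
        - (((-8 : ℝ) - 4 * Real.sqrt 2) / U - ((270559 : ℝ) + 358949 * Real.sqrt 2) / 4096 / (U : ℝ) ^ 3)) =
      ((U : ℝ) * Model.energy (hubbardRingTV 4 1 U) 2 2 + 8 + 4 * Real.sqrt 2) / 4
        + ((270559 : ℝ) + 358949 * Real.sqrt 2) / 16384 / (U : ℝ) ^ 2 := by
    field_simp; ring
  linarith [h1, e]

/-- **THE STRONG-COUPLING LIMIT OF THE SCALED LEVEL-DQG GAP OF THE 4-RING EXISTS AND IS `√2 − 1`**:
`(U/4)·(E₀(4;U) − OPT_DQG(4;U)) → √2 − 1` as `U → ∞` along `ℚ` (the ceiling of §3 against gen 42's kernel floor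
`LiftL4.eventually_le_scaled_gap`; the `E₀` side is the typer's `U·E₀ → −12`). -/
theorem tendsto_scaled_gap :
    Tendsto (fun U : ℚ => (U : ℝ) / 4 *
      (Model.energy (hubbardRingTV 4 1 U) 2 2 - Model.pqgSectorEnergy (hubbardRingTV 4 1 U) 2 2)) atTop (𝓝 (Real.sqrt 2 - 1)) := by
  have hE := tendsto_mul_energy_hubbardRingTV_four
  have hcast : Tendsto (fun U : ℚ => (U : ℝ)) atTop atTop := tendsto_ratCast_atTop_iff.2 tendsto_id
  have hsq : Tendsto (fun U : ℚ => (U : ℝ) ^ 2) atTop atTop := (tendsto_pow_atTop two_ne_zero).comp hcast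
  have hinv : Tendsto (fun U : ℚ => ((270559 : ℝ) + 358949 * Real.sqrt 2) / 16384 / (U : ℝ) ^ 2) atTop (𝓝 0) :=
    tendsto_const_nhds.div_atTop hsq
  have hg : Tendsto (fun U : ℚ => ((U : ℝ) * Model.energy (hubbardRingTV 4 1 U) 2 2 + 8 + 4 * Real.sqrt 2) / 4
      + ((270559 : ℝ) + 358949 * Real.sqrt 2) / 16384 / (U : ℝ) ^ 2) atTop (𝓝 (((-12 : ℝ) + 8 + 4 * Real.sqrt 2) / 4 + 0)) :=
    (((hE.add_const 8).add_const (4 * Real.sqrt 2)).div_const 4).add hinv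
  rw [show ((-12 : ℝ) + 8 + 4 * Real.sqrt 2) / 4 + 0 = Real.sqrt 2 - 1 by ring] at hg
  rw [tendsto_order]
  refine ⟨fun a ha => ?_, fun b hb => ?_⟩
  · have hc : (a + (Real.sqrt 2 - 1)) / 2 < Real.sqrt 2 - 1 := by linarith
    filter_upwards [LiftL4.eventually_le_scaled_gap hc] with U hU
    linarith
  · filter_upwards [(tendsto_order.1 hg).2 b hb, eventually_gt_atTop (0 : ℚ)] with U h1 h2
    exact lt_of_le_of_lt (scaled_gap_le U h2) h1

/-! ## §4 Read against the conjecture leaves: the `n = 2` clause of `ConjectureSU2_DQG` / `ConjectureSU_DQG`, `c 2 = √2 − 1` -/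

/-- The `n = 2` instance of the `Tendsto` conjunct of `ConjectureSU2_DQG` / `ConjectureSU_DQG`, in the leaves' spelling
(`hubbardRingTV (2*n) 1 U` at `n = 2`), with the conjectured value `c 2 = √2 − 1`. -/
theorem conjectureSU2_DQG_tendsto_two :
    Tendsto (fun U : ℚ => ((U : ℝ) / 4) *
      (Model.energy (hubbardRingTV (2 * 2) 1 U) 2 2 - Model.pqgSectorEnergy (hubbardRingTV (2 * 2) 1 U) 2 2))
        atTop (𝓝 (Real.sqrt 2 - 1)) :=
  tendsto_scaled_gap

/-- **Any plateau function satisfying the conjecture's level-DQG convergence clause has `c 2 = √2 − 1`** (limits along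
`atTop (ℚ)` are unique). -/
theorem eq_sqrt_two_sub_one_of_clause {c : ℕ → ℝ}
    (h : ∀ n, 2 ≤ n → 0 ≤ c n ∧
      Tendsto (fun U : ℚ => ((U : ℝ) / 4) *
          (Model.energy (hubbardRingTV (2 * n) 1 U) n n - Model.pqgSectorEnergy (hubbardRingTV (2 * n) 1 U) n n))
        atTop (𝓝 (c n))) :
    c 2 = Real.sqrt 2 - 1 :=
  tendsto_nhds_unique (h 2 le_rfl).2 conjectureSU2_DQG_tendsto_two

end DualL4.SectorDQG

end Summit.Ventures.CertifiedQuantumChemistry
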